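import Summits.KontsevichZagierPeriods.Zeta5Search.TwoTaleSecondTaleDecayHolds
import Summits.KontsevichZagierPeriods.Zeta5Search.TwoTaleP15CoincidenceW1
import HarnessLib

/-!
# The irrationality exponent of `ζ(2) = π²/6` is at most `5.0499` (two-tale point P15, route W1)

HONEST FRAMING: systematic search; no irrationality claim unless certified. This file asserts nothing about
`ζ(5)`. It draws together, with NO hypothesis, the two tree theorems

* `TwoTaleSecondTaleDecayHolds.decayT_holds_W1 : DecayT 25.5` (fam-measure g5/g6, P1 g10's line
  certificate; files fam-measure 12–18, p260589 … p264401) — the tale-2 decay at the partner parameters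
  `(aT n, bT n)` of Zudilin's second hypergeometric tale, and
* `TwoTaleP15CoincidenceW1.zetaTwo_exponent_le_of_decayT_W1 : DecayT c' → 25.5 ≤ c' →
  ExponentLE (zetaValue 2) 5.0499 ∧ zetaTwo_irrationalityExponent_le` (P1 g10, p259174) — the
  `(bmiss)`-free route W1: Whipple's transformation for the `q`-half, first-tale decay and arithmetic,
  seven unconditional tale-2 `p`-adic cells, the slice `p > 17n`, the crude small-prime bound, and the
  normaliser `D₁₇ₙ² E_n²`.

RESULT: `zetaTwo_exponent_le_P15 : ExponentLE (zetaValue 2) 5.0499`, restated in Mathlib terms only as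
`pi_sq_div_six_not_liouvilleWith : ∀ p > 5.0499, ¬ LiouvilleWith p (π²/6)` (via `ζ(2) = π²/6`, Mathlib
`hasSum_zeta_two`).

READING (fixed by the referee seat, REFEREE.md Round 70, R70.4; ruling R6(e) "referee first" was followed:
the composite term was probed hypothesis-free with standard axioms and the tale-2 decay constant re-derived
independently BEFORE this file was written): "μ(π²) = μ(ζ(2)) ≤ 5.0499 is a kernel theorem of the tree: for
every p > 5.0499, π²/6 is not Liouville with exponent p. It lies below the printed record μ(ζ(2)) ≤ 5.095412 of
[Zudilin 2014, Thm 1] [cite: Zudilin2014ZetaTwo, Theorem 1]. It is obtained at the two-tale point P15 by the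
(bmiss)-free route W1; the printed conjectural identity (bmiss) is not used." CAVEATS (verbatim with every use):
the [Zu14] inputs are the tree's own kernel-checked formalisations (the paper is cited for provenance); the
human-readable proof (paper §M) must be written and refereed before prose claims; 5.0499 is the constant of W1 as
filed, not optimised — and, as ledger facts since R70.4 recorded by the referee (R71.3; ref-2 R-2.134), the two other
endgames are unconditional as well: the ♭ leg `Denom.TwoTaleP15IntegralTHolds.integralTFlat_holds` (p265275, used with
`TwoTaleSecondTaleDecayHolds.decayT_holds_floor : DecayT 28.462`) and the top-window leg
`Denom.TwoTaleP15Prop3.prop3T_holds` (p264432) ∧ `Denom.TwoTaleP15Window.topWindowT_holds` (p260615), so the tree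
holds THREE hypothesis-free kernel derivations — W1; ♭; Prop. 3 ∧ Theorem W — of ONE bound, all sharing the tale-2
decay and the first-tale inputs (three derivations of the same number, not three numbers); this is a measure bound for
the known-irrational number π², not an irrationality proof, and has no bearing on ζ(5).

File written by the filing lane (lead/lit g13) to the referee's specification (R70, step (3)) on behalf of the
owners P1 g10 (W1) and fam-measure g5/g6 (U2); cell pub-zeta5.
-/

namespace Summit.KontsevichZagierPeriods.Zeta5Search.TwoTaleP15Measure

open Literature.NumberTheory.Transcendental (zetaValue)

/-- **`μ(ζ(2)) ≤ 5.0499`**: the irrationality exponent of `ζ(2)` is at most `5.0499`, with no hypothesis —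
`ExponentLE ξ κ := ∀ p, κ < p → ¬ LiouvilleWith p ξ` (`MeasureRecords`). Below the printed record `5.095412`
[cite: Zudilin2014ZetaTwo, Theorem 1]; route W1 at the two-tale point P15 (see the module docstring). -/
theorem zetaTwo_exponent_le_P15 : ExponentLE (zetaValue 2) 5.0499 :=
  (TwoTaleP15CoincidenceW1.zetaTwo_exponent_le_of_decayT_W1
    TwoTaleSecondTaleDecayHolds.decayT_holds_W1 (by norm_num)).1

/-- The printed record statement `zetaTwo_irrationalityExponent_le` (μ(ζ(2)) ≤ 5.09541179, [Zudilin 2014, Thm 1])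
is a COROLLARY of route W1 in the tree (second component of P1 g10's endgame), not a cited fact here.
[cite: Zudilin2014ZetaTwo, Theorem 1] -/
theorem zetaTwo_irrationalityExponent_le_of_W1 :
    Literature.NumberTheory.Irrationality.Zudilin2014.zetaTwo_irrationalityExponent_le :=
  (TwoTaleP15CoincidenceW1.zetaTwo_exponent_le_of_decayT_W1
    TwoTaleSecondTaleDecayHolds.decayT_holds_W1 (by norm_num)).2

/-- **`μ(π²/6) ≤ 5.0499` in Mathlib terms only** (the referee's junk-value-free restatement, R70.3 (c)):
for every real `p > 5.0499`, `π²/6` is not Liouville with exponent `p`. [cite: Zudilin2014ZetaTwo, Theorem 1] -/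
theorem pi_sq_div_six_not_liouvilleWith :
    ∀ p : ℝ, (5.0499 : ℝ) < p → ¬ LiouvilleWith p (Real.pi ^ 2 / 6) := by
  intro p hp
  -- `ζ(2) = π²/6` for the tree's `zetaValue 2 = ∑' n, 1/n²` is Mathlib's `hasSum_zeta_two`; the tree already
  -- has it as `…HurwitzMicroSectors.NormalFormPrinciple.PiBox.LevelOne.zetaValue_two_eq` (a different
  -- sub-problem's theorem tower), so the two-line Mathlib step is inlined here rather than re-declared or
  -- imported across sub-problems.
  have h2 : zetaValue 2 = Real.pi ^ 2 / 6 := by rw [zetaValue]; exact hasSum_zeta_two.tsum_eq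
  rw [← h2]
  exact zetaTwo_exponent_le_P15 p hp

end Summit.KontsevichZagierPeriods.Zeta5Search.TwoTaleP15Measure
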